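import Summits.NavierStokesRegularity.FunctionalMining.NoGo.PalinstrophySupRate

/-!
# Functional mining NO-GO #4 (statement): the log door K1-Q3(a) fails below the threshold `2/π`

Search for candidate a priori estimates; no regularity claim.

Cell `pub-nsfunc` (host summit NavierStokesRegularity, topic `FunctionalMining`), NO-GO branch, gen 4
(no-go seat; STAGED for the prove seat — planner seats do not file under `FunctionalMining/`; intended
home: a section of `FunctionalMining/PalinstrophyLogDoor.lean` next to the dictionary's
`not_palinstrophyLogBudget_of_static_violation`, or `NoGo/PalinstrophyLogThreshold.lean`).
Paper-level proof: `pub-nsfunc-nogo/THRESHOLD.md` (UNREVIEWED).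

THEOREM T (NO-GO #4, threshold form; THRESHOLD.md §0–§4). For every `c > 0` and every `C < 2/π` the
typed log-door candidate `PalinstrophyLogBudget C c` (`Candidates.lean`, K1-Q3(a):
`d𝒫/dt ≤ C‖ω‖_∞𝒫 log(e + c𝒫/ν²)` along classical solutions on `T³`) is FALSE: an explicit smooth
divergence-free "2.5-dimensional" field `v = (u_L(x,y), W(x,y))` — `u_L` the planar velocity of an
ANGULARLY regularised checkerboard corner (vorticity `g_ε(θ)` cut off inside radius `δ`), `W` a
vertical-velocity tube packet `(1/k) φ(x,y) cos(ky)` sitting on the corner — violates the STATIC form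
`2N − 2νD₃ ≤ C M 𝒫 log(e + c𝒫/ν²)` after amplitude rescaling, and the tree's dynamic ⇒ static reduction
`PalinstrophyLogBudget.static` (`NoGo/PalinstrophySupRate.lean`) closes the door. Bookkeeping: the packet
converts the corner strain `s = (2/π)log(1/δ) + O(1)` into `2N/𝒫 → 4s = (8/π)log(1/δ)` (exact packet
identities, Lemma A′, verified in rational arithmetic), while the optimal amplitude costs
`log(A²𝒫) = 4 log(1/δ) + O(log log(1/δ))` because the angular regularisation keeps the background
palinstrophy at `O(ε⁻¹ log(1/δ))` (Lemma B′); `(8/π)/4 = 2/π`. The earlier constants `8/(9π)` (DICTIONARY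
N10) and `4/(7π)` (LOGDOOR §3) are the thresholds of sub-optimal sub-families (THRESHOLD.md §0 table);
`2/π` is the exact ceiling of every "packet on a logarithmic strain corner" witness (§6). Complement
(dictionary, `KTImpliesLogBudget`): the door is expected TRUE for `C ≥ C⋆(c)`, so K1-Q3(a) is a threshold
law with true threshold `C₀(c) ∈ [2/π, C⋆(c)]`; and `C₀(c) ≥ (2/π − o(1)) log(1/c)` as `c → 0` (§5).

This file only TYPES the threshold statement and proves the bookkeeping around it:
* `PalinstrophyLogBudgetFailsBelow C₀` — `∀ c > 0, ∀ C < C₀, ¬ PalinstrophyLogBudget C c`;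
* `PalinstrophyLogThreshold` — **NO-GO #4**: `PalinstrophyLogBudgetFailsBelow (2/π)` (conjecture-tagged =
  to be proved in the tree; paper-level proof complete);
* `PalinstrophyLogBudgetFailsSmallC κ` — the small-`c` form `C < κ log(1/c)` (§5; theorem on paper for
  every `κ < 2/π`);
* proved: antitonicity in `C₀`, and the door in threshold form
  `palinstrophyLogBudgetFailsBelow_of_static_violations` (a family of static violations, one for each
  `(C, c)` below the threshold, gives the threshold statement — from the tree's
  `PalinstrophyLogBudget.static`; this is what a formal proof of NO-GO #4 has to feed).
Nothing is asserted about Navier–Stokes. [ours — internal, unreviewed]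
-/

noncomputable section

open Set MeasureTheory
open scoped InnerProductSpace RealInnerProductSpace

namespace Summit.NavierStokesRegularity.FunctionalMining

open Literature.Analysis.FunctionSpaces Literature.Analysis.FluidPDE

variable {d : Type*} [Fintype d] [DecidableEq d]

/-- **The log door fails below `C₀`:** for every `c > 0` and every `C < C₀`, `¬ PalinstrophyLogBudget C c`.
Meaningful at `Fintype.card d = 3` (for other index types `PalinstrophyLogBudget` is vacuously true).
Search for candidate a priori estimates; no regularity claim — nothing is asserted. -/
@[conjecture] def PalinstrophyLogBudgetFailsBelow (C₀ : ℝ) : Prop :=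
  ∀ c : ℝ, 0 < c → ∀ C : ℝ, C < C₀ → ¬ PalinstrophyLogBudget (d := d) C c

/-- **NO-GO #4 (nogo seat gen 4; paper-level proof `pub-nsfunc-nogo/THRESHOLD.md`, UNREVIEWED):** the log
door K1-Q3(a) fails for every `c > 0` and every `C < 2/π` (angularly regularised corner × vertical tube
packet; `2/π = (gain 8/π)/(cost 4)`). To be PROVED in the tree (hence conjecture-tagged here). Search for
candidate a priori estimates; no regularity claim — nothing is asserted. -/
@[conjecture] def PalinstrophyLogThreshold : Prop :=
  PalinstrophyLogBudgetFailsBelow (d := d) (2 / Real.pi)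

/-- **Small-`c` form (THRESHOLD.md §5):** there is `c₀ > 0` such that for all `0 < c < c₀` and all
`C < κ · log(1/c)` the log door fails. Theorem on paper for every `κ < 2/π` (same witness, the inner scale
`δ` tied to `c` by `4 log(1/δ) ≈ log(1/c)`); the dictionary's conditional upper threshold
`palinstrophyLogConst` grows like `log(1/c)` too. Search for candidate a priori estimates; no regularity
claim — nothing is asserted. -/
@[conjecture] def PalinstrophyLogBudgetFailsSmallC (κ : ℝ) : Prop :=
  ∃ c₀ : ℝ, 0 < c₀ ∧ ∀ c : ℝ, 0 < c → c < c₀ → ∀ C : ℝ, C < κ * Real.log (1 / c) →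
    ¬ PalinstrophyLogBudget (d := d) C c

/-- A smaller threshold is the weaker statement. [folklore] -/
theorem palinstrophyLogBudgetFailsBelow_anti {C₀ C₀' : ℝ} (hle : C₀' ≤ C₀)
    (h : PalinstrophyLogBudgetFailsBelow (d := d) C₀) : PalinstrophyLogBudgetFailsBelow (d := d) C₀' :=
  fun c hc C hC => h c hc C (hC.trans_le hle)

/-- NO-GO #4 implies every smaller threshold, e.g. the dictionary's `8/(9π)` and LOGDOOR's `4/(7π)`
(both `< 2/π`). [folklore] -/
theorem palinstrophyLogBudgetFailsBelow_of_threshold {C₀ : ℝ} (hC₀ : C₀ ≤ 2 / Real.pi)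
    (h : PalinstrophyLogThreshold (d := d)) : PalinstrophyLogBudgetFailsBelow (d := d) C₀ :=
  palinstrophyLogBudgetFailsBelow_anti hC₀ h

/-- **The door in threshold form.** If for every `c > 0` and every `C < C₀` some smooth divergence-free
field `v` on `T³`, some `ν > 0` and some admissible vorticity bound `M ≥ 0` violate the static inequality
`2N(v) − 2νD₃(v) ≤ C·M·𝒫(v)·log(e + c𝒫(v)/ν²)`, then the log door fails below `C₀`. Immediate from the
tree's dynamic ⇒ static reduction `PalinstrophyLogBudget.static` (p200052); this is the shape in which a
formal proof of NO-GO #4 (one explicit field per `(C, c)`, THRESHOLD.md §4) enters. Search for candidate a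
priori estimates; no regularity claim. [ours] -/
theorem palinstrophyLogBudgetFailsBelow_of_static_violations (hd : Fintype.card d = 3) {C₀ : ℝ}
    (h : ∀ c : ℝ, 0 < c → ∀ C : ℝ, C < C₀ →
      ∃ ν : ℝ, 0 < ν ∧ ∃ v : UnitAddTorus d → EuclideanSpace ℝ d, ∃ M : ℝ,
        Torus.IsSmooth v ∧ Torus.IsDivFree v ∧ 0 ≤ M ∧ (∀ x, torusVorticitySqAt v x ≤ M ^ 2) ∧
        C * M * torusPalinstrophy v * Real.log (Real.exp 1 + c * torusPalinstrophy v / ν ^ 2) <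
          2 * palinstrophyProduction v - 2 * ν * palinstrophyDissipation v) :
    PalinstrophyLogBudgetFailsBelow (d := d) C₀ := by
  intro c hc C hC hbud
  obtain ⟨ν, hν, v, M, hv, hdiv, hM, hMx, hviol⟩ := h c hc C hC
  exact (hviol.trans_le (hbud.static hd hν hv hdiv hM hMx)).false

/-- Conversely-shaped bookkeeping: a threshold statement at `C₀` refutes the door at every single
`(C, c)` with `c > 0`, `C < C₀`. [folklore] -/
theorem not_palinstrophyLogBudget_of_failsBelow {C₀ C c : ℝ}
    (h : PalinstrophyLogBudgetFailsBelow (d := d) C₀) (hc : 0 < c) (hC : C < C₀) :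
    ¬ PalinstrophyLogBudget (d := d) C c :=
  h c hc C hC

end Summit.NavierStokesRegularity.FunctionalMining

end
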